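import Literature.MathematicalPhysics.QuantumLattice.PartialParticleHole
import Literature.MathematicalPhysics.QuantumLattice.TwoClusterFock
import HarnessLib

/-!
# Fermion parity under Lieb's partial particle–hole transformation

HONEST FRAMING: first certified bounds; not a superconductivity verdict. Nothing here is a number or a row. This is
the «PARITY IS LOAD-BEARING» sentence of the FORMAT-mpsgf1 co-read (sr-mbsolver-var-4, R2) as a kernel theorem, written
by the IRD desk (sr-mbsolver-ird-5): the partial particle–hole unitary `W = partialParticleHole D` of the tree
(`PartialParticleHole.lean`, `W|s⟩ = w_D(s)|s ∆ D⟩`) maps a vector supported on configurations of parity `p` to one of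
parity `p + |D|` — because `|s ∆ D| ≡ |s| + |D| (mod 2)`. With `D` = the `ab` down-spin orbitals of an open
`a × b` box and `ψ̃` the integer MPS of a FORMAT-mpsgf1 certificate (fixed transformed particle number `Ñ`, FORMAT §2 V1),
`ψ = W ψ̃` has fermion parity `(Ñ + ab) mod 2` — the first conjunct `HasParity ((Ñ+ab) % 2) ψ` of every sourced-box
claim node (= `HasParity 0` for `Ñ = ab`).

* `card_symmDiff_mod_two`: `|s ∆ t| % 2 = (|s| + |t|) % 2`;
* `hasParity_partialParticleHole_mulVec`: `HasParity p ψ → HasParity (p + |D|) (W ψ)`;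
* `hasParity_partialParticleHole_mulVec_of_isNParticle`: the `N`-particle special case.
-/

noncomputable section
namespace Summit.Ventures.CertifiedManyBodySolver
open Matrix Finset Literature.MathematicalPhysics.QuantumLattice
open Literature.MathematicalPhysics.QuantumLattice.TwoCluster HubbardWave0
open scoped symmDiff

section PHParity

variable {ι : Type*} [LinearOrder ι]

omit [LinearOrder ι] in
/-- `|s ∆ t| ≡ |s| + |t| (mod 2)`. [folklore] -/
theorem card_symmDiff_mod_two [DecidableEq ι] (s t : Finset ι) : (s ∆ t).card % 2 = (s.card + t.card) % 2 := by
  have h1 := Finset.card_sdiff_add_card_inter s t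
  have h2 := Finset.card_sdiff_add_card_inter t s
  have h3 : (s ∆ t).card = (s \ t).card + (t \ s).card := by
    rw [symmDiff_def, Finset.sup_eq_union, Finset.card_union_of_disjoint disjoint_sdiff_sdiff]
  rw [Finset.inter_comm] at h2
  omega

variable [Fintype ι]

/-- **Parity under the partial particle–hole map**: if `ψ` is supported on configurations of cardinality
`≡ p (mod 2)`, then `W ψ = partialParticleHole D *ᵥ ψ` is supported on cardinalities `≡ p + |D| (mod 2)`.
[cite: Lieb1989, proof of Theorem 2] -/
theorem hasParity_partialParticleHole_mulVec {p : ℕ} {ψ : Fock ι} (D : Finset ι) (hψ : HasParity p ψ) :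
    HasParity (p + D.card) (partialParticleHole D *ᵥ ψ) := by
  intro t ht
  rw [partialParticleHole_mulVec_apply] at ht
  have hψt : ψ (t ∆ D) ≠ 0 := fun h => ht (by rw [h, mul_zero])
  have h1 := hψ _ hψt
  have h2 := card_symmDiff_mod_two t D
  have h3 : ((t ∆ D) ∆ D).card = t.card := by rw [Literature.MathematicalPhysics.QuantumLattice.symmDiff_symmDiff_self']
  have h4 := card_symmDiff_mod_two (t ∆ D) D
  rw [h3] at h4
  omega

/-- The `N`-particle case: `W` maps an `N`-particle vector to a vector of parity `N + |D|` — for the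
FORMAT-mpsgf1 witness (`Ñ`-particle in the transformed frame, `|D| = ab` down orbitals) this is the node's
`HasParity ((Ñ + ab) % 2)`. [cite: Lieb1989, proof of Theorem 2] -/
theorem hasParity_partialParticleHole_mulVec_of_isNParticle {N : ℕ} {ψ : Fock ι} (D : Finset ι)
    (hψ : IsNParticle N ψ) : HasParity (N + D.card) (partialParticleHole D *ᵥ ψ) :=
  hasParity_partialParticleHole_mulVec D (hasParity_of_isNParticle hψ)

end PHParity
end Summit.Ventures.CertifiedManyBodySolver
end
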